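import Literature.MathematicalPhysics.QuantumLattice.HubbardSliceSymbolSmoothXiFourth
import HarnessLib

/-!
# The MIXED derivatives `∂_ξ ∂_ω^a W` (`a ≤ 3`) of the slice weight `W = χ₂((ω²+ξ²)/Λ²) − χ₂((ω²+ξ²)/Λ′²)`:
# formulas, `ξ`-differentiability of `W, W′, W″, W‴`, bounds `≲ B/Λ^{a+1}`, vanishing off the shell

Topic `MathematicalPhysics/QuantumLattice`; continues `HubbardSliceSymbolSmooth` (`sliceWeightFn`, `sliceWeightFnD1`, `sliceWeightFnD2` — the weight
and its frequency derivatives), `…XiThird` (`sliceWeightFnD3`) and `…XiFourth` (`χ₂⁗`, its support and bound `B₄`).  In the flow-piece telescoping of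
the WEIGHTED slice propagator (Benfatto–Giuliani–Mastropietro 2006, §3 (3.2)–(3.8)) the `m`-th increment `Ψ̂(ω, e + w) − Ψ̂(ω, e)` must be small in
EVERY direction of the dual torus, in particular its third TIME differences must carry the factor `|w|`; that is the mean value inequality in the
band variable `ξ` applied to the frequency derivatives `∂_ω^aΨ̂`, `a ≤ 3`, whose `ξ`-derivatives are the mixed derivatives.  This file is the WEIGHT
half (the resolvent half is `∂_ξ R^{(a)} = i·R^{(a+1)}`):

* §1 `hasDerivAt_sqArg_xi`, `sliceWeightFn_comm`, `hasDerivAt_sliceWeightFn_xi` — `∂_ξ W(ξ,ω) = sliceWeightFnD1 Λ Λ′ ω ξ` (symmetry of `ω² + ξ²`);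
* §2 `sliceWeightFnD1Xi`, `sliceWeightFnD2Xi`, `sliceWeightFnD3Xi` — the formulas of `∂_ξW′`, `∂_ξW″`, `∂_ξW‴` — with
  `hasDerivAt_sliceWeightFnD1_xi`, `hasDerivAt_sliceWeightFnD2_xi`, `hasDerivAt_sliceWeightFnD3_xi`;
* §3 bounds `|∂_ξW′| ≤ 8B₂/Λ²`, `|∂_ξW″| ≤ (16B₃+8B₂)/Λ³`, `|∂_ξW‴| ≤ (32B₄+48B₃)/Λ⁴` (`0 < Λ ≤ Λ′`) and vanishing off the closed shell
  `Λ²/4 ≤ ω²+ξ² ≤ Λ′²` (`sliceWeightFnDXi_eq_zero_of_not_mem`).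

Everything is proved; no named facts.

## Sources

G. Benfatto, A. Giuliani, V. Mastropietro, Ann. Henri Poincaré 7 (2006) 809–898, (2.36aa), §3 (3.2)–(3.8) (`BenfattoGiulianiMastropietro2006`);
M. Salmhofer, *Renormalization* (1999), §4.2.5 (4.70)–(4.71) (`Salmhofer1999`).
-/

noncomputable section

namespace Literature.MathematicalPhysics.QuantumLattice

open Literature.Probability.LatticeModels Set

/-! ### §1 The weight as a function of the band variable -/

/-- The argument `(ω² + t²)/Λ²` has `t`-derivative `2ξ/Λ²` at `ξ`. [cite: Salmhofer1999, §4.2.5 (4.70)] -/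
theorem hasDerivAt_sqArg_xi (Λ ω ξ : ℝ) : HasDerivAt (fun t : ℝ => (ω ^ 2 + t ^ 2) / Λ ^ 2) (2 * ξ / Λ ^ 2) ξ := by
  have h := ((hasDerivAt_pow 2 ξ).const_add (ω ^ 2)).div_const (Λ ^ 2)
  simpa [pow_one, mul_comm] using h

/-- The weight is symmetric in `(ξ, ω)`: `W(Λ,Λ′,ξ,ω) = W(Λ,Λ′,ω,ξ)`. [cite: Salmhofer1999, §4.2.5 (4.70)] -/
theorem sliceWeightFn_comm (Λ Λ' ξ ω : ℝ) : sliceWeightFn Λ Λ' ξ ω = sliceWeightFn Λ Λ' ω ξ := by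
  simp only [sliceWeightFn, add_comm (ω ^ 2) (ξ ^ 2)]

/-- **`∂_ξ W = W′` with the slots swapped**: `t ↦ W(Λ,Λ′,t,ω)` has derivative `sliceWeightFnD1 Λ Λ′ ω ξ` at `ξ`. [cite: Salmhofer1999, §4.2.5 (4.70)] -/
theorem hasDerivAt_sliceWeightFn_xi (Λ Λ' ξ ω : ℝ) :
    HasDerivAt (fun t : ℝ => sliceWeightFn Λ Λ' t ω) (sliceWeightFnD1 Λ Λ' ω ξ) ξ := by
  have h := hasDerivAt_sliceWeightFn Λ Λ' ω ξ
  have e : (fun t : ℝ => sliceWeightFn Λ Λ' t ω) = sliceWeightFn Λ Λ' ω := funext fun t => sliceWeightFn_comm Λ Λ' t ω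
  rw [e]; exact h

/-! ### §2 The mixed derivatives: formulas and `ξ`-differentiability of `W′, W″, W‴` -/

/-- `∂_ξ W′ = χ₂″(h/Λ²)(2ξ/Λ²)(2ω/Λ²) − (Λ′ term)`. [cite: Salmhofer1999, §4.2.5 (4.70)] -/
def sliceWeightFnD1Xi (Λ Λ' ξ ω : ℝ) : ℝ :=
  deriv (deriv salmhoferCutoff) ((ω ^ 2 + ξ ^ 2) / Λ ^ 2) * (2 * ξ / Λ ^ 2) * (2 * ω / Λ ^ 2) -
    deriv (deriv salmhoferCutoff) ((ω ^ 2 + ξ ^ 2) / Λ' ^ 2) * (2 * ξ / Λ' ^ 2) * (2 * ω / Λ' ^ 2)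

/-- `∂_ξ W″ = [χ₂‴(h/Λ²)(2ξ/Λ²)(2ω/Λ²)² + χ₂″(h/Λ²)(2ξ/Λ²)(2/Λ²)] − (Λ′ terms)`. [cite: Salmhofer1999, §4.2.5 (4.70)] -/
def sliceWeightFnD2Xi (Λ Λ' ξ ω : ℝ) : ℝ :=
  (deriv (deriv (deriv salmhoferCutoff)) ((ω ^ 2 + ξ ^ 2) / Λ ^ 2) * (2 * ξ / Λ ^ 2) * (2 * ω / Λ ^ 2) * (2 * ω / Λ ^ 2) +
      deriv (deriv salmhoferCutoff) ((ω ^ 2 + ξ ^ 2) / Λ ^ 2) * (2 * ξ / Λ ^ 2) * (2 / Λ ^ 2)) -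
    (deriv (deriv (deriv salmhoferCutoff)) ((ω ^ 2 + ξ ^ 2) / Λ' ^ 2) * (2 * ξ / Λ' ^ 2) * (2 * ω / Λ' ^ 2) * (2 * ω / Λ' ^ 2) +
      deriv (deriv salmhoferCutoff) ((ω ^ 2 + ξ ^ 2) / Λ' ^ 2) * (2 * ξ / Λ' ^ 2) * (2 / Λ' ^ 2))

/-- `∂_ξ W‴ = [χ₂⁗(h/Λ²)(2ξ/Λ²)(2ω/Λ²)³ + 3·χ₂‴(h/Λ²)(2ξ/Λ²)(2ω/Λ²)(2/Λ²)] − (Λ′ terms)`. [cite: Salmhofer1999, §4.2.5 (4.70)] -/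
def sliceWeightFnD3Xi (Λ Λ' ξ ω : ℝ) : ℝ :=
  (deriv (deriv (deriv (deriv salmhoferCutoff))) ((ω ^ 2 + ξ ^ 2) / Λ ^ 2) * (2 * ξ / Λ ^ 2) * (2 * ω / Λ ^ 2) * (2 * ω / Λ ^ 2) *
        (2 * ω / Λ ^ 2) +
      3 * (deriv (deriv (deriv salmhoferCutoff)) ((ω ^ 2 + ξ ^ 2) / Λ ^ 2) * (2 * ξ / Λ ^ 2) * (2 * ω / Λ ^ 2) * (2 / Λ ^ 2))) -
    (deriv (deriv (deriv (deriv salmhoferCutoff))) ((ω ^ 2 + ξ ^ 2) / Λ' ^ 2) * (2 * ξ / Λ' ^ 2) * (2 * ω / Λ' ^ 2) * (2 * ω / Λ' ^ 2) *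
        (2 * ω / Λ' ^ 2) +
      3 * (deriv (deriv (deriv salmhoferCutoff)) ((ω ^ 2 + ξ ^ 2) / Λ' ^ 2) * (2 * ξ / Λ' ^ 2) * (2 * ω / Λ' ^ 2) * (2 / Λ' ^ 2)))

/-- One cutoff term of `W′` is `ξ`-differentiable with derivative the corresponding term of `∂_ξW′`. [cite: Salmhofer1999, §4.2.5 (4.70)] -/
theorem hasDerivAt_deriv_term_xi (Λ ω ξ : ℝ) :
    HasDerivAt (fun t : ℝ => deriv salmhoferCutoff ((ω ^ 2 + t ^ 2) / Λ ^ 2) * (2 * ω / Λ ^ 2))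
      (deriv (deriv salmhoferCutoff) ((ω ^ 2 + ξ ^ 2) / Λ ^ 2) * (2 * ξ / Λ ^ 2) * (2 * ω / Λ ^ 2)) ξ :=
  ((hasDerivAt_deriv_salmhoferCutoff _).comp ξ (hasDerivAt_sqArg_xi Λ ω ξ)).mul_const _

/-- One cutoff term of `W″` is `ξ`-differentiable with derivative the corresponding term of `∂_ξW″`. [cite: Salmhofer1999, §4.2.5 (4.70)] -/
theorem hasDerivAt_deriv2_term_xi (Λ ω ξ : ℝ) :
    HasDerivAt (fun t : ℝ => deriv (deriv salmhoferCutoff) ((ω ^ 2 + t ^ 2) / Λ ^ 2) * (2 * ω / Λ ^ 2) * (2 * ω / Λ ^ 2) +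
        deriv salmhoferCutoff ((ω ^ 2 + t ^ 2) / Λ ^ 2) * (2 / Λ ^ 2))
      (deriv (deriv (deriv salmhoferCutoff)) ((ω ^ 2 + ξ ^ 2) / Λ ^ 2) * (2 * ξ / Λ ^ 2) * (2 * ω / Λ ^ 2) * (2 * ω / Λ ^ 2) +
        deriv (deriv salmhoferCutoff) ((ω ^ 2 + ξ ^ 2) / Λ ^ 2) * (2 * ξ / Λ ^ 2) * (2 / Λ ^ 2)) ξ :=
  ((((hasDerivAt_deriv_deriv_salmhoferCutoff _).comp ξ (hasDerivAt_sqArg_xi Λ ω ξ)).mul_const _).mul_const _).add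
    (((hasDerivAt_deriv_salmhoferCutoff _).comp ξ (hasDerivAt_sqArg_xi Λ ω ξ)).mul_const _)

/-- One cutoff term of `W‴` is `ξ`-differentiable with derivative the corresponding term of `∂_ξW‴`. [cite: Salmhofer1999, §4.2.5 (4.70)] -/
theorem hasDerivAt_deriv3_term_xi (Λ ω ξ : ℝ) :
    HasDerivAt (fun t : ℝ => deriv (deriv (deriv salmhoferCutoff)) ((ω ^ 2 + t ^ 2) / Λ ^ 2) * (2 * ω / Λ ^ 2) * (2 * ω / Λ ^ 2) *
          (2 * ω / Λ ^ 2) +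
        3 * (deriv (deriv salmhoferCutoff) ((ω ^ 2 + t ^ 2) / Λ ^ 2) * (2 * ω / Λ ^ 2) * (2 / Λ ^ 2)))
      (deriv (deriv (deriv (deriv salmhoferCutoff))) ((ω ^ 2 + ξ ^ 2) / Λ ^ 2) * (2 * ξ / Λ ^ 2) * (2 * ω / Λ ^ 2) * (2 * ω / Λ ^ 2) *
          (2 * ω / Λ ^ 2) +
        3 * (deriv (deriv (deriv salmhoferCutoff)) ((ω ^ 2 + ξ ^ 2) / Λ ^ 2) * (2 * ξ / Λ ^ 2) * (2 * ω / Λ ^ 2) * (2 / Λ ^ 2))) ξ :=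
  (((((hasDerivAt_deriv_deriv_deriv_salmhoferCutoff _).comp ξ (hasDerivAt_sqArg_xi Λ ω ξ)).mul_const _).mul_const _).mul_const _).add
    (((((hasDerivAt_deriv_deriv_salmhoferCutoff _).comp ξ (hasDerivAt_sqArg_xi Λ ω ξ)).mul_const _).mul_const _).const_mul _)

/-- **`∂_ξ W′ = sliceWeightFnD1Xi`**: `t ↦ W′(Λ,Λ′,t,ω)` has derivative `sliceWeightFnD1Xi Λ Λ′ ξ ω` at `ξ`. [cite: Salmhofer1999, §4.2.5 (4.70)] -/
theorem hasDerivAt_sliceWeightFnD1_xi (Λ Λ' ξ ω : ℝ) :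
    HasDerivAt (fun t : ℝ => sliceWeightFnD1 Λ Λ' t ω) (sliceWeightFnD1Xi Λ Λ' ξ ω) ξ := by
  unfold sliceWeightFnD1 sliceWeightFnD1Xi
  exact (hasDerivAt_deriv_term_xi Λ ω ξ).sub (hasDerivAt_deriv_term_xi Λ' ω ξ)

/-- **`∂_ξ W″ = sliceWeightFnD2Xi`.** [cite: Salmhofer1999, §4.2.5 (4.70)] -/
theorem hasDerivAt_sliceWeightFnD2_xi (Λ Λ' ξ ω : ℝ) :
    HasDerivAt (fun t : ℝ => sliceWeightFnD2 Λ Λ' t ω) (sliceWeightFnD2Xi Λ Λ' ξ ω) ξ := by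
  unfold sliceWeightFnD2 sliceWeightFnD2Xi
  exact (hasDerivAt_deriv2_term_xi Λ ω ξ).sub (hasDerivAt_deriv2_term_xi Λ' ω ξ)

/-- **`∂_ξ W‴ = sliceWeightFnD3Xi`.** [cite: Salmhofer1999, §4.2.5 (4.70)] -/
theorem hasDerivAt_sliceWeightFnD3_xi (Λ Λ' ξ ω : ℝ) :
    HasDerivAt (fun t : ℝ => sliceWeightFnD3 Λ Λ' t ω) (sliceWeightFnD3Xi Λ Λ' ξ ω) ξ := by
  unfold sliceWeightFnD3 sliceWeightFnD3Xi
  exact (hasDerivAt_deriv3_term_xi Λ ω ξ).sub (hasDerivAt_deriv3_term_xi Λ' ω ξ)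

/-! ### §3 Bounds and vanishing -/

/-- On the support of `χ₂^{(k)}((ω²+ξ²)/Λ²)` both variables are at most `Λ` in absolute value. [cite: Salmhofer1999, §4.2.5 (4.71)] -/
theorem abs_le_of_sqArg_le_one {Λ ξ ω : ℝ} (hΛ : 0 < Λ) (h : ¬ 1 < (ω ^ 2 + ξ ^ 2) / Λ ^ 2) : |ξ| ≤ Λ ∧ |ω| ≤ Λ := by
  rw [not_lt, div_le_one (by positivity)] at h
  have hξ : ξ ^ 2 ≤ Λ ^ 2 := by nlinarith [sq_nonneg ω]
  have hω : ω ^ 2 ≤ Λ ^ 2 := by nlinarith [sq_nonneg ξ]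
  exact ⟨abs_le_of_sq_le_sq' hξ hΛ.le |>.elim (fun h1 h2 => abs_le.2 ⟨h1, h2⟩),
    abs_le_of_sq_le_sq' hω hΛ.le |>.elim (fun h1 h2 => abs_le.2 ⟨h1, h2⟩)⟩

section Bounds

variable {B₂ B₃ B₄ : ℝ}

/-- One cutoff term of `∂_ξW′`: `|χ₂″(u)(2ξ/Λ²)(2ω/Λ²)| ≤ 4B₂/Λ²`. [cite: BenfattoGiulianiMastropietro2006, (2.36aa)] -/
theorem abs_deriv_term_xi_le (hB₂ : ∀ x, |deriv (deriv salmhoferCutoff) x| ≤ B₂) {Λ : ℝ} (hΛ : 0 < Λ) (ξ ω : ℝ) :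
    |deriv (deriv salmhoferCutoff) ((ω ^ 2 + ξ ^ 2) / Λ ^ 2) * (2 * ξ / Λ ^ 2) * (2 * ω / Λ ^ 2)| ≤ 4 * B₂ / Λ ^ 2 := by
  have hB20 : 0 ≤ B₂ := (abs_nonneg _).trans (hB₂ 0)
  by_cases hgt : 1 < (ω ^ 2 + ξ ^ 2) / Λ ^ 2
  · rw [deriv_deriv_salmhoferCutoff_eq_zero_of_gt hgt, zero_mul, zero_mul, abs_zero]; positivity
  · obtain ⟨hξ, hω⟩ := abs_le_of_sqArg_le_one hΛ hgt
    rw [mul_assoc, abs_mul]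
    have hprod : |2 * ξ / Λ ^ 2 * (2 * ω / Λ ^ 2)| ≤ 4 / Λ ^ 2 := by
      rw [show 2 * ξ / Λ ^ 2 * (2 * ω / Λ ^ 2) = 4 * (ξ * ω) / (Λ ^ 2 * Λ ^ 2) by field_simp; ring, abs_div,
        abs_of_pos (by positivity : (0 : ℝ) < Λ ^ 2 * Λ ^ 2), abs_mul, abs_of_pos (by norm_num : (0 : ℝ) < 4), abs_mul,
        div_le_div_iff₀ (by positivity) (by positivity)]
      have : |ξ| * |ω| ≤ Λ * Λ := mul_le_mul hξ hω (abs_nonneg _) hΛ.le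
      nlinarith [pow_pos hΛ 2]
    calc _ ≤ B₂ * (4 / Λ ^ 2) := mul_le_mul (hB₂ _) hprod (abs_nonneg _) hB20
      _ = 4 * B₂ / Λ ^ 2 := by ring

/-- One cutoff term of `∂_ξW″`: `≤ (8B₃ + 4B₂)/Λ³`. [cite: BenfattoGiulianiMastropietro2006, (2.36aa)] -/
theorem abs_deriv2_term_xi_le (hB₂ : ∀ x, |deriv (deriv salmhoferCutoff) x| ≤ B₂)
    (hB₃ : ∀ x, |deriv (deriv (deriv salmhoferCutoff)) x| ≤ B₃) {Λ : ℝ} (hΛ : 0 < Λ) (ξ ω : ℝ) :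
    |deriv (deriv (deriv salmhoferCutoff)) ((ω ^ 2 + ξ ^ 2) / Λ ^ 2) * (2 * ξ / Λ ^ 2) * (2 * ω / Λ ^ 2) * (2 * ω / Λ ^ 2) +
        deriv (deriv salmhoferCutoff) ((ω ^ 2 + ξ ^ 2) / Λ ^ 2) * (2 * ξ / Λ ^ 2) * (2 / Λ ^ 2)| ≤ (8 * B₃ + 4 * B₂) / Λ ^ 3 := by
  have hB20 : 0 ≤ B₂ := (abs_nonneg _).trans (hB₂ 0)
  have hB30 : 0 ≤ B₃ := (abs_nonneg _).trans (hB₃ 0)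
  by_cases hgt : 1 < (ω ^ 2 + ξ ^ 2) / Λ ^ 2
  · rw [deriv_deriv_salmhoferCutoff_eq_zero_of_gt hgt, deriv_deriv_deriv_salmhoferCutoff_eq_zero_of_gt hgt]
    simp only [zero_mul, add_zero, abs_zero]; positivity
  · obtain ⟨hξ, hω⟩ := abs_le_of_sqArg_le_one hΛ hgt
    have hfirst : |deriv (deriv (deriv salmhoferCutoff)) ((ω ^ 2 + ξ ^ 2) / Λ ^ 2) * (2 * ξ / Λ ^ 2) * (2 * ω / Λ ^ 2) *
        (2 * ω / Λ ^ 2)| ≤ 8 * B₃ / Λ ^ 3 := by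
      rw [mul_assoc, mul_assoc, abs_mul]
      have hprod : |2 * ξ / Λ ^ 2 * (2 * ω / Λ ^ 2 * (2 * ω / Λ ^ 2))| ≤ 8 / Λ ^ 3 := by
        rw [show 2 * ξ / Λ ^ 2 * (2 * ω / Λ ^ 2 * (2 * ω / Λ ^ 2)) = 8 * (ξ * (ω * ω)) / (Λ ^ 2 * Λ ^ 2 * Λ ^ 2) by field_simp; ring,
          abs_div, abs_of_pos (by positivity : (0 : ℝ) < Λ ^ 2 * Λ ^ 2 * Λ ^ 2), abs_mul, abs_of_pos (by norm_num : (0 : ℝ) < 8),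
          abs_mul, abs_mul, div_le_div_iff₀ (by positivity) (by positivity)]
        have h2 : |ω| * |ω| ≤ Λ * Λ := mul_le_mul hω hω (abs_nonneg _) hΛ.le
        have h3 : |ξ| * (|ω| * |ω|) ≤ Λ * (Λ * Λ) := mul_le_mul hξ h2 (by positivity) hΛ.le
        nlinarith [pow_pos hΛ 2, pow_pos hΛ 3]
      calc _ ≤ B₃ * (8 / Λ ^ 3) := mul_le_mul (hB₃ _) hprod (abs_nonneg _) hB30
        _ = 8 * B₃ / Λ ^ 3 := by ring
    have hsecond : |deriv (deriv salmhoferCutoff) ((ω ^ 2 + ξ ^ 2) / Λ ^ 2) * (2 * ξ / Λ ^ 2) * (2 / Λ ^ 2)| ≤ 4 * B₂ / Λ ^ 3 := by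
      rw [mul_assoc, abs_mul]
      have hprod : |2 * ξ / Λ ^ 2 * (2 / Λ ^ 2)| ≤ 4 / Λ ^ 3 := by
        rw [show 2 * ξ / Λ ^ 2 * (2 / Λ ^ 2) = 4 * ξ / (Λ ^ 2 * Λ ^ 2) by field_simp; ring, abs_div,
          abs_of_pos (by positivity : (0 : ℝ) < Λ ^ 2 * Λ ^ 2), abs_mul, abs_of_pos (by norm_num : (0 : ℝ) < 4),
          div_le_div_iff₀ (by positivity) (by positivity)]
        nlinarith [pow_pos hΛ 2, pow_pos hΛ 3, abs_nonneg ξ]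
      calc _ ≤ B₂ * (4 / Λ ^ 3) := mul_le_mul (hB₂ _) hprod (abs_nonneg _) hB20
        _ = 4 * B₂ / Λ ^ 3 := by ring
    calc _ ≤ _ := abs_add_le _ _
      _ ≤ 8 * B₃ / Λ ^ 3 + 4 * B₂ / Λ ^ 3 := add_le_add hfirst hsecond
      _ = (8 * B₃ + 4 * B₂) / Λ ^ 3 := by ring

/-- One cutoff term of `∂_ξW‴`: `≤ (16B₄ + 24B₃)/Λ⁴`. [cite: BenfattoGiulianiMastropietro2006, (2.36aa)] -/
theorem abs_deriv3_term_xi_le (hB₃ : ∀ x, |deriv (deriv (deriv salmhoferCutoff)) x| ≤ B₃)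
    (hB₄ : ∀ x, |deriv (deriv (deriv (deriv salmhoferCutoff))) x| ≤ B₄) {Λ : ℝ} (hΛ : 0 < Λ) (ξ ω : ℝ) :
    |deriv (deriv (deriv (deriv salmhoferCutoff))) ((ω ^ 2 + ξ ^ 2) / Λ ^ 2) * (2 * ξ / Λ ^ 2) * (2 * ω / Λ ^ 2) * (2 * ω / Λ ^ 2) *
          (2 * ω / Λ ^ 2) +
        3 * (deriv (deriv (deriv salmhoferCutoff)) ((ω ^ 2 + ξ ^ 2) / Λ ^ 2) * (2 * ξ / Λ ^ 2) * (2 * ω / Λ ^ 2) * (2 / Λ ^ 2))| ≤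
      (16 * B₄ + 24 * B₃) / Λ ^ 4 := by
  have hB30 : 0 ≤ B₃ := (abs_nonneg _).trans (hB₃ 0)
  have hB40 : 0 ≤ B₄ := (abs_nonneg _).trans (hB₄ 0)
  by_cases hgt : 1 < (ω ^ 2 + ξ ^ 2) / Λ ^ 2
  · rw [deriv_deriv_deriv_salmhoferCutoff_eq_zero_of_gt hgt, deriv4_salmhoferCutoff_eq_zero_of_gt hgt]
    simp only [zero_mul, mul_zero, add_zero, abs_zero]; positivity
  · obtain ⟨hξ, hω⟩ := abs_le_of_sqArg_le_one hΛ hgt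
    have h2 : |ω| * |ω| ≤ Λ * Λ := mul_le_mul hω hω (abs_nonneg _) hΛ.le
    have hfirst : |deriv (deriv (deriv (deriv salmhoferCutoff))) ((ω ^ 2 + ξ ^ 2) / Λ ^ 2) * (2 * ξ / Λ ^ 2) * (2 * ω / Λ ^ 2) *
        (2 * ω / Λ ^ 2) * (2 * ω / Λ ^ 2)| ≤ 16 * B₄ / Λ ^ 4 := by
      rw [mul_assoc, mul_assoc, mul_assoc, abs_mul]
      have hprod : |2 * ξ / Λ ^ 2 * (2 * ω / Λ ^ 2 * (2 * ω / Λ ^ 2 * (2 * ω / Λ ^ 2)))| ≤ 16 / Λ ^ 4 := by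
        rw [show 2 * ξ / Λ ^ 2 * (2 * ω / Λ ^ 2 * (2 * ω / Λ ^ 2 * (2 * ω / Λ ^ 2))) =
            16 * (ξ * (ω * (ω * ω))) / (Λ ^ 2 * Λ ^ 2 * Λ ^ 2 * Λ ^ 2) by field_simp; ring,
          abs_div, abs_of_pos (by positivity : (0 : ℝ) < Λ ^ 2 * Λ ^ 2 * Λ ^ 2 * Λ ^ 2), abs_mul,
          abs_of_pos (by norm_num : (0 : ℝ) < 16), abs_mul, abs_mul, abs_mul, div_le_div_iff₀ (by positivity) (by positivity)]
        have h3 : |ω| * (|ω| * |ω|) ≤ Λ * (Λ * Λ) := mul_le_mul hω h2 (by positivity) hΛ.le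
        have h4 : |ξ| * (|ω| * (|ω| * |ω|)) ≤ Λ * (Λ * (Λ * Λ)) := mul_le_mul hξ h3 (by positivity) hΛ.le
        nlinarith [pow_pos hΛ 2, pow_pos hΛ 4]
      calc _ ≤ B₄ * (16 / Λ ^ 4) := mul_le_mul (hB₄ _) hprod (abs_nonneg _) hB40
        _ = 16 * B₄ / Λ ^ 4 := by ring
    have hsecond : |3 * (deriv (deriv (deriv salmhoferCutoff)) ((ω ^ 2 + ξ ^ 2) / Λ ^ 2) * (2 * ξ / Λ ^ 2) * (2 * ω / Λ ^ 2) *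
        (2 / Λ ^ 2))| ≤ 24 * B₃ / Λ ^ 4 := by
      rw [abs_mul, abs_of_pos (by norm_num : (0 : ℝ) < 3), mul_assoc, mul_assoc, abs_mul]
      have hprod : |2 * ξ / Λ ^ 2 * (2 * ω / Λ ^ 2 * (2 / Λ ^ 2))| ≤ 8 / Λ ^ 4 := by
        rw [show 2 * ξ / Λ ^ 2 * (2 * ω / Λ ^ 2 * (2 / Λ ^ 2)) = 8 * (ξ * ω) / (Λ ^ 2 * Λ ^ 2 * Λ ^ 2) by field_simp; ring,
          abs_div, abs_of_pos (by positivity : (0 : ℝ) < Λ ^ 2 * Λ ^ 2 * Λ ^ 2), abs_mul, abs_of_pos (by norm_num : (0 : ℝ) < 8),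
          abs_mul, div_le_div_iff₀ (by positivity) (by positivity)]
        have h3 : |ξ| * |ω| ≤ Λ * Λ := mul_le_mul hξ hω (abs_nonneg _) hΛ.le
        nlinarith [pow_pos hΛ 2, pow_pos hΛ 4]
      calc 3 * (|deriv (deriv (deriv salmhoferCutoff)) ((ω ^ 2 + ξ ^ 2) / Λ ^ 2)| * |2 * ξ / Λ ^ 2 * (2 * ω / Λ ^ 2 * (2 / Λ ^ 2))|)
          ≤ 3 * (B₃ * (8 / Λ ^ 4)) := mul_le_mul_of_nonneg_left (mul_le_mul (hB₃ _) hprod (abs_nonneg _) hB30) (by norm_num)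
        _ = 24 * B₃ / Λ ^ 4 := by ring
    calc _ ≤ _ := abs_add_le _ _
      _ ≤ 16 * B₄ / Λ ^ 4 + 24 * B₃ / Λ ^ 4 := add_le_add hfirst hsecond
      _ = (16 * B₄ + 24 * B₃) / Λ ^ 4 := by ring

/-- **`|∂_ξW′| ≤ 8B₂/Λ²`** (`0 < Λ ≤ Λ′`). [cite: BenfattoGiulianiMastropietro2006, (2.36aa)] -/
theorem abs_sliceWeightFnD1Xi_le (hB₂ : ∀ x, |deriv (deriv salmhoferCutoff) x| ≤ B₂) {Λ Λ' : ℝ} (hΛ : 0 < Λ) (hΛΛ' : Λ ≤ Λ')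
    (ξ ω : ℝ) : |sliceWeightFnD1Xi Λ Λ' ξ ω| ≤ 8 * B₂ / Λ ^ 2 := by
  have hB20 : 0 ≤ B₂ := (abs_nonneg _).trans (hB₂ 0)
  have hΛ' : 0 < Λ' := hΛ.trans_le hΛΛ'
  unfold sliceWeightFnD1Xi
  refine (abs_sub _ _).trans ?_
  have h1 := abs_deriv_term_xi_le hB₂ hΛ ξ ω
  have h2 := abs_deriv_term_xi_le hB₂ hΛ' ξ ω
  have h3 : 4 * B₂ / Λ' ^ 2 ≤ 4 * B₂ / Λ ^ 2 :=
    div_le_div_of_nonneg_left (by positivity) (by positivity) (pow_le_pow_left₀ hΛ.le hΛΛ' 2)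
  calc _ ≤ 4 * B₂ / Λ ^ 2 + 4 * B₂ / Λ' ^ 2 := add_le_add h1 h2
    _ ≤ 4 * B₂ / Λ ^ 2 + 4 * B₂ / Λ ^ 2 := by linarith
    _ = 8 * B₂ / Λ ^ 2 := by ring

/-- **`|∂_ξW″| ≤ (16B₃ + 8B₂)/Λ³`** (`0 < Λ ≤ Λ′`). [cite: BenfattoGiulianiMastropietro2006, (2.36aa)] -/
theorem abs_sliceWeightFnD2Xi_le (hB₂ : ∀ x, |deriv (deriv salmhoferCutoff) x| ≤ B₂)
    (hB₃ : ∀ x, |deriv (deriv (deriv salmhoferCutoff)) x| ≤ B₃) {Λ Λ' : ℝ} (hΛ : 0 < Λ) (hΛΛ' : Λ ≤ Λ') (ξ ω : ℝ) :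
    |sliceWeightFnD2Xi Λ Λ' ξ ω| ≤ (16 * B₃ + 8 * B₂) / Λ ^ 3 := by
  have hB20 : 0 ≤ B₂ := (abs_nonneg _).trans (hB₂ 0)
  have hB30 : 0 ≤ B₃ := (abs_nonneg _).trans (hB₃ 0)
  have hΛ' : 0 < Λ' := hΛ.trans_le hΛΛ'
  unfold sliceWeightFnD2Xi
  refine (abs_sub _ _).trans ?_
  have h1 := abs_deriv2_term_xi_le hB₂ hB₃ hΛ ξ ω
  have h2 := abs_deriv2_term_xi_le hB₂ hB₃ hΛ' ξ ω
  have h3 : (8 * B₃ + 4 * B₂) / Λ' ^ 3 ≤ (8 * B₃ + 4 * B₂) / Λ ^ 3 :=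
    div_le_div_of_nonneg_left (by positivity) (by positivity) (pow_le_pow_left₀ hΛ.le hΛΛ' 3)
  calc _ ≤ (8 * B₃ + 4 * B₂) / Λ ^ 3 + (8 * B₃ + 4 * B₂) / Λ' ^ 3 := add_le_add h1 h2
    _ ≤ (8 * B₃ + 4 * B₂) / Λ ^ 3 + (8 * B₃ + 4 * B₂) / Λ ^ 3 := by linarith
    _ = (16 * B₃ + 8 * B₂) / Λ ^ 3 := by ring

/-- **`|∂_ξW‴| ≤ (32B₄ + 48B₃)/Λ⁴`** (`0 < Λ ≤ Λ′`). [cite: BenfattoGiulianiMastropietro2006, (2.36aa)] -/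
theorem abs_sliceWeightFnD3Xi_le (hB₃ : ∀ x, |deriv (deriv (deriv salmhoferCutoff)) x| ≤ B₃)
    (hB₄ : ∀ x, |deriv (deriv (deriv (deriv salmhoferCutoff))) x| ≤ B₄) {Λ Λ' : ℝ} (hΛ : 0 < Λ) (hΛΛ' : Λ ≤ Λ') (ξ ω : ℝ) :
    |sliceWeightFnD3Xi Λ Λ' ξ ω| ≤ (32 * B₄ + 48 * B₃) / Λ ^ 4 := by
  have hB30 : 0 ≤ B₃ := (abs_nonneg _).trans (hB₃ 0)
  have hB40 : 0 ≤ B₄ := (abs_nonneg _).trans (hB₄ 0)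
  have hΛ' : 0 < Λ' := hΛ.trans_le hΛΛ'
  unfold sliceWeightFnD3Xi
  refine (abs_sub _ _).trans ?_
  have h1 := abs_deriv3_term_xi_le hB₃ hB₄ hΛ ξ ω
  have h2 := abs_deriv3_term_xi_le hB₃ hB₄ hΛ' ξ ω
  have h3 : (16 * B₄ + 24 * B₃) / Λ' ^ 4 ≤ (16 * B₄ + 24 * B₃) / Λ ^ 4 :=
    div_le_div_of_nonneg_left (by positivity) (by positivity) (pow_le_pow_left₀ hΛ.le hΛΛ' 4)
  calc _ ≤ (16 * B₄ + 24 * B₃) / Λ ^ 4 + (16 * B₄ + 24 * B₃) / Λ' ^ 4 := add_le_add h1 h2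
    _ ≤ (16 * B₄ + 24 * B₃) / Λ ^ 4 + (16 * B₄ + 24 * B₃) / Λ ^ 4 := by linarith
    _ = (32 * B₄ + 48 * B₃) / Λ ^ 4 := by ring

end Bounds

/-- **Off the closed shell `Λ²/4 ≤ ω²+ξ² ≤ Λ′²` the three mixed derivatives vanish** (`0 < Λ ≤ Λ′`). [cite: Salmhofer1999, §4.2.5 (4.71)] -/
theorem sliceWeightFnDXi_eq_zero_of_not_mem {Λ Λ' : ℝ} (hΛ : 0 < Λ) (hΛΛ' : Λ ≤ Λ') {ξ ω : ℝ}
    (h : ω ^ 2 + ξ ^ 2 < Λ ^ 2 / 4 ∨ Λ' ^ 2 < ω ^ 2 + ξ ^ 2) :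
    sliceWeightFnD1Xi Λ Λ' ξ ω = 0 ∧ sliceWeightFnD2Xi Λ Λ' ξ ω = 0 ∧ sliceWeightFnD3Xi Λ Λ' ξ ω = 0 := by
  have hΛ' : 0 < Λ' := hΛ.trans_le hΛΛ'
  have hΛ2 : Λ ^ 2 ≤ Λ' ^ 2 := pow_le_pow_left₀ hΛ.le hΛΛ' 2
  unfold sliceWeightFnD1Xi sliceWeightFnD2Xi sliceWeightFnD3Xi
  rcases h with h | h
  · have h1 : (ω ^ 2 + ξ ^ 2) / Λ ^ 2 < 1 / 4 := by rw [div_lt_iff₀ (by positivity)]; linarith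
    have h2 : (ω ^ 2 + ξ ^ 2) / Λ' ^ 2 < 1 / 4 := by
      rw [div_lt_iff₀ (by positivity)]; nlinarith [sq_nonneg ω, sq_nonneg ξ]
    simp [deriv_deriv_salmhoferCutoff_eq_zero_of_lt h1, deriv_deriv_salmhoferCutoff_eq_zero_of_lt h2,
      deriv_deriv_deriv_salmhoferCutoff_eq_zero_of_lt h1, deriv_deriv_deriv_salmhoferCutoff_eq_zero_of_lt h2,
      deriv4_salmhoferCutoff_eq_zero_of_lt h1, deriv4_salmhoferCutoff_eq_zero_of_lt h2]
  · have h1 : 1 < (ω ^ 2 + ξ ^ 2) / Λ ^ 2 := by rw [lt_div_iff₀ (by positivity)]; linarith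
    have h2 : 1 < (ω ^ 2 + ξ ^ 2) / Λ' ^ 2 := by rw [lt_div_iff₀ (by positivity)]; linarith
    simp [deriv_deriv_salmhoferCutoff_eq_zero_of_gt h1, deriv_deriv_salmhoferCutoff_eq_zero_of_gt h2,
      deriv_deriv_deriv_salmhoferCutoff_eq_zero_of_gt h1, deriv_deriv_deriv_salmhoferCutoff_eq_zero_of_gt h2,
      deriv4_salmhoferCutoff_eq_zero_of_gt h1, deriv4_salmhoferCutoff_eq_zero_of_gt h2]

end Literature.MathematicalPhysics.QuantumLattice

end
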